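import Literature.Probability.RandomPlanarGeometry.HexSAWHammersleyWelshExplicit
import Literature.Probability.RandomPlanarGeometry.HexSAWBridgeLogDecay
import Literature.Probability.RandomPlanarGeometry.HexSAWLattice
import Mathlib.Analysis.Complex.ExponentialBounds
import HarnessLib

/-!
# All-`n` improvements of Hammersley–Welsh on the honeycomb lattice, with numerals:
# `c_n(ℍ) ≤ 24·exp(17800 √n (ln n)^{-1/6})·μⁿ` for all `n ≥ 2`, and `c_n ≤ A_κ e^{κ√n} μⁿ` for every `κ > 0`

Topic `Literature/Probability/RandomPlanarGeometry`. Sources: J. M. Hammersley, D. J. A. Welsh,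
*Further results on the rate of convergence to the connective constant of the hypercubical lattice*,
Quart. J. Math. Oxford 13 (1962) (`c_n ≤ e^{κ√n} μⁿ`); A. Glazman, I. Manolescu, AIHP 56 (2020)
(arXiv:1708.00395), Proposition 1.1 (p. 4: `B_T(π/3) → 0`; "Moreover `B_T(π/3) < 1/(log T)^{1/3}` for
infinitely many values of `T`"); H. Duminil-Copin, S. Ganguly, A. Hammond, I. Manolescu, *Bounding the number of self-avoiding
walks: Hammersley–Welsh with polygon insertion*, Ann. Probab. 48 (2020) (arXiv:1809.00760), Theorem 1.3
(p. 3): "Let `ε ∈ (0, 1/42)`. Then, for any `n ∈ ℕ` high enough, `|SAW_n(ℍ)| ≤ exp(n^{1/2−ε}) μ(ℍ)^n`"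
(the printed comparison point: a better exponent, with an inexplicit threshold and no constants).

This file instantiates the master inequality of `HexSAWHammersleyWelshExplicit.lean`
(`hexSawCount_le_exp_of_le_half`: `c_n ≤ 8μ·exp(2nt + 64μ³ Σ_{T≤n+1} (1−t)^{2T} B_T(x_c))·μⁿ`) on two
inputs that the tree proves unconditionally:

* `bridgeSum_le_of_lt` — the splitting `Σ_{T≤N} (1−t)^{2T} B_T ≤ M + w/t` whenever `B_T ≤ w` for `T > M`
  (`B_T ≤ 1` below `M`, geometric tail above);
* **`hexHWExplicit_of_pos : ∀ κ > 0, ∃ A, HexHWExplicit A κ`** — from `B_T(x_c) → 0`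
  (`HV.tendsto_stripBlim`, Glazman–Manolescu Prop. 1.1): the Hammersley–Welsh constant `κ` of the
  honeycomb lattice can be taken arbitrarily small, for ALL `n ≥ 1` (`A = A(κ)` not computed);
  instances `hexHWExplicit_fourteen` (`κ = 14`) and `hexHWExplicit_sharp` (`κ = 2√(1+μ_ℍ)`), the two
  rungs of lane «pcv-sawmu» Sketch_G11 §R55;
* `HexHWLogStretched A K` (`∀ n ≥ 2, c_n ≤ A exp(K√n (ln n)^{-1/6}) μⁿ`, Sketch_G11 §R57 verbatim),
  **`hexHWLogStretched_of_logDecay`** (`0 < C → HexBridgeLogDecay C T₀ → ∃ A K > 0, HexHWLogStretched A K`;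
  `t := (4√n (ln n)^{1/6})⁻¹`, split at `M = ⌈n^{1/4}⌉`) and the unconditional
  **`hexHWLogStretched : ∃ A K, 0 < A ∧ 0 < K ∧ HexHWLogStretched A K`** from
  `hexBridgeLogDecay : HexBridgeLogDecay 5 2` (`HexSAWBridgeLogDecay.lean`);
* `HexBridgeExponent b₁ b₂ T₀` (hypothesis schema: a `T^{-1/4}` window, Sketch_G11 §R54), `bridgeDecay_of_eventually`,
  and the CONDITIONAL `hexHWStretched_of_bridgeExponent` (exponent `3/7` for all `n ≥ 1`);
* constants exposed and NUMERALS: `hexHWLogStretched_explicit_of_logDecay` (`A = 8μ_ℍ + c_2`,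
  `K = 1/2 + 64μ_ℍ³(max(T₀,2) + 2 + 8C)`), `HexHWLogStretched.mono`, `hexSawCount_one_le` (`c_1 ≤ 3`),
  `hexSawCount_two_le` (`c_2 ≤ 9`), `hexConnectiveConstant_le` (`μ_ℍ ≤ 37/20`, `μ_ℍ³ ≤ 158/25`), and
  **`hexHWLogStretched_numeral : HexHWLogStretched 24 17800`** —
  `c_n(ℍ) ≤ 24·exp(17800·√n·(ln n)^{-1/6})·μ_ℍⁿ` for every `n ≥ 2`.

Printed status and label of record (lane «pcv-sawmu» routes R55/R57, a-idea-1 ROUTES-G11; printed-status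
cells lit-1 g7, referee §31, 2026-08-22): Hammersley–Welsh's `e^{κ√n}` and DCGHM's `exp(n^{1/2−ε})`
(`ε < 1/42`, `n ≥ n₀` inexplicit) are printed, and Hutchcroft 2018 gives `o(√n)`; the `∃ A K` / `∃ A`
statements of this file are, statement-wise, corollaries of DCGHM Theorem 1.3 as printed, obtained here by
an independent kernel route (Glazman–Manolescu decay through the Hammersley–Welsh product, no polygon
insertion); the NUMERAL statement `hexHWLogStretched_numeral` (`A = 24`, `K = 17800`, every `n ≥ 2`) is not
derivable from print (no numeral threshold or constant is printed) and is asymptotically WEAKER than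
DCGHM's exponent. No claim beyond this is made.
-/

noncomputable section

open Finset Filter Topology

namespace Literature.Probability.RandomPlanarGeometry.SAW

open HV

/-! ### Splitting the critical bridge sum at a width `M` -/

/-- Geometric tail: `Σ_{M ≤ T < M+N} (1−t)^{2(T+1)} ≤ t⁻¹` for `0 < t ≤ 1/2`. [folklore] -/
private theorem sum_Ico_geom_le {t : ℝ} (ht0 : 0 < t) (ht : t ≤ 1 / 2) (M N : ℕ) :
    ∑ T ∈ Ico M (M + N), (1 - t) ^ (2 * (T + 1)) ≤ t⁻¹ := by
  have hq1 : (1 - t) ^ 2 < 1 := by nlinarith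
  have hq0 : 0 ≤ (1 - t) ^ 2 := sq_nonneg _
  have hq1' : (1 - t) ^ 2 ≤ 1 := hq1.le
  calc ∑ T ∈ Ico M (M + N), (1 - t) ^ (2 * (T + 1))
      ≤ ∑ T ∈ Ico M (M + N), ((1 - t) ^ 2) ^ T := by
        refine sum_le_sum fun T _ => ?_
        rw [pow_mul]
        exact pow_le_pow_of_le_one hq0 hq1' (Nat.le_succ T)
    _ ≤ ((1 - t) ^ 2) ^ M / (1 - (1 - t) ^ 2) := geom_sum_Ico_le_of_lt_one hq0 hq1
    _ ≤ 1 / (1 - (1 - t) ^ 2) :=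
        div_le_div_of_nonneg_right (pow_le_one₀ hq0 hq1') (by nlinarith)
    _ ≤ t⁻¹ := by
        rw [one_div, inv_le_inv₀ (by nlinarith) ht0]; nlinarith

/-- **Splitting the critical bridge sum**: if `B_T(x_c) ≤ w` for every `T > M` (`w ≥ 0`), then for
`0 < t ≤ 1/2` and every `N`, `Σ_{T=1}^{N} (1−t)^{2T} B_T(x_c) ≤ M + w·t⁻¹` (`B_T ≤ 1` for the `M` small
widths, a geometric tail for the others). [cite: DuminilCopinSmirnov2012, §3 (proof of Theorem 1, "Σ_T B_T^x converges")] -/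
theorem bridgeSum_le_of_lt {t w : ℝ} (ht0 : 0 < t) (ht : t ≤ 1 / 2) (hw : 0 ≤ w) {M : ℕ}
    (hB : ∀ T : ℕ, M < T → stripBlim T ≤ w) (N : ℕ) :
    ∑ T ∈ range N, (1 - t) ^ (2 * (T + 1)) * stripBlim (T + 1) ≤ M + w * t⁻¹ := by
  have h1t : 0 ≤ 1 - t := by linarith
  have h1t1 : 1 - t ≤ 1 := by linarith
  have hterm0 : ∀ T : ℕ, 0 ≤ (1 - t) ^ (2 * (T + 1)) * stripBlim (T + 1) := fun T =>
    mul_nonneg (pow_nonneg h1t _) (stripBlim_nonneg (by omega))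
  have hsplit : ∑ T ∈ range N, (1 - t) ^ (2 * (T + 1)) * stripBlim (T + 1) ≤
      ∑ T ∈ range M, (1 - t) ^ (2 * (T + 1)) * stripBlim (T + 1) +
        ∑ T ∈ Ico M (M + N), (1 - t) ^ (2 * (T + 1)) * stripBlim (T + 1) := by
    rw [← sum_union (disjoint_left.2 fun a ha hb => by
      rw [mem_range] at ha; rw [mem_Ico] at hb; omega)]
    refine sum_le_sum_of_subset_of_nonneg (fun T hT => ?_) fun T _ _ => hterm0 T
    rw [mem_union, mem_range, mem_Ico]; rw [mem_range] at hT; omega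
  have hhead : ∑ T ∈ range M, (1 - t) ^ (2 * (T + 1)) * stripBlim (T + 1) ≤ M := by
    calc ∑ T ∈ range M, (1 - t) ^ (2 * (T + 1)) * stripBlim (T + 1) ≤ ∑ T ∈ range M, (1 : ℝ) :=
          sum_le_sum fun T _ => mul_le_one₀ (pow_le_one₀ h1t h1t1) (stripBlim_nonneg (by omega))
            (stripBlim_le_one (by omega))
      _ = M := by simp
  have htail : ∑ T ∈ Ico M (M + N), (1 - t) ^ (2 * (T + 1)) * stripBlim (T + 1) ≤ w * t⁻¹ := by
    calc ∑ T ∈ Ico M (M + N), (1 - t) ^ (2 * (T + 1)) * stripBlim (T + 1)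
        ≤ ∑ T ∈ Ico M (M + N), (1 - t) ^ (2 * (T + 1)) * w := by
          refine sum_le_sum fun T hT => mul_le_mul_of_nonneg_left (hB (T + 1) ?_) (pow_nonneg h1t _)
          rw [mem_Ico] at hT; omega
      _ = (∑ T ∈ Ico M (M + N), (1 - t) ^ (2 * (T + 1))) * w := by rw [sum_mul]
      _ ≤ t⁻¹ * w := mul_le_mul_of_nonneg_right (sum_Ico_geom_le ht0 ht M N) hw
      _ = w * t⁻¹ := mul_comm _ _
  linarith

/-! ### Every Hammersley–Welsh constant `κ > 0` on `ℍ`, from `B_T(x_c) → 0` -/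

/-- **For every `κ > 0` there is `A` with `c_n(ℍ) ≤ A e^{κ√n} μ_ℍⁿ` for all `n ≥ 1`**: since
`B_T(x_c) → 0` (Glazman–Manolescu), the bridge sum in the Hammersley–Welsh product is `≤ M + ε/t` with
`ε` as small as we please; `t := a/√n`, `a = κ/4`, `ε = κa/(128μ³)` give the exponent `κ√n + 64μ³M`,
and the finitely many `n < 4a²` are absorbed by `A` (`t = 1/2` there). `A` is not computed.
[cite: GlazmanManolescu2019, Proposition 1.1] -/
theorem hexHWExplicit_of_pos {κ : ℝ} (hκ : 0 < κ) : ∃ A : ℝ, HexHWExplicit A κ := by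
  set μ := hexConnectiveConstant with hμ
  have hμpos : 0 < μ := hexConnectiveConstant_pos
  have hμ1 : 1 ≤ μ := one_le_hexConnectiveConstant
  set a : ℝ := κ / 4 with ha
  have ha0 : 0 < a := by positivity
  set ε : ℝ := κ * a / (128 * μ ^ 3) with hε
  have hε0 : 0 < ε := by positivity
  -- `B_T ≤ ε` for `T > M`
  obtain ⟨M, hM⟩ := Metric.tendsto_atTop.1 tendsto_stripBlim ε hε0
  have hB : ∀ T : ℕ, M < T → stripBlim T ≤ ε := by
    intro T hT
    have h := hM T hT.le
    rw [Real.dist_eq, sub_zero] at h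
    exact (le_abs_self _).trans h.le
  -- threshold `N₁ = ⌈4a²⌉`: for `n ≥ N₁`, `t = a/√n ≤ 1/2`
  set N₁ := ⌈4 * a ^ 2⌉₊ with hN₁
  refine ⟨8 * μ * (Real.exp (64 * μ ^ 3 * M) + Real.exp (128 * μ ^ 3 + N₁)), fun n hn => ?_⟩
  have hnpos : (0 : ℝ) < n := by exact_mod_cast hn
  have hsq : 0 < Real.sqrt n := Real.sqrt_pos.2 hnpos
  have hexpκ : 1 ≤ Real.exp (κ * Real.sqrt n) := Real.one_le_exp (by positivity)
  have hμn : 0 ≤ μ ^ n := pow_nonneg hμpos.le n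
  rcases Nat.lt_or_ge n N₁ with hsmall | hbig
  · -- small `n`: `t = 1/2`, bridge sum `≤ 0 + 1·2`
    have hW := bridgeSum_le_of_lt (t := 1 / 2) (w := 1) (M := 0) (by norm_num) le_rfl zero_le_one
      (fun T hT => stripBlim_le_one (by omega)) (n + 1)
    have hmain := hexSawCount_le_exp_of_le_half n (t := 1 / 2) (by norm_num) le_rfl
    have hexpo : 2 * (n : ℝ) * (1 / 2) + 64 * μ ^ 3 *
        ∑ T ∈ range (n + 1), (1 - 1 / 2 : ℝ) ^ (2 * (T + 1)) * stripBlim (T + 1) ≤ 128 * μ ^ 3 + N₁ := by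
      have hn' : (n : ℝ) ≤ N₁ := by exact_mod_cast hsmall.le
      have : 64 * μ ^ 3 * ∑ T ∈ range (n + 1), (1 - 1 / 2 : ℝ) ^ (2 * (T + 1)) * stripBlim (T + 1) ≤
          64 * μ ^ 3 * ((0 : ℕ) + 1 * (1 / 2 : ℝ)⁻¹) := mul_le_mul_of_nonneg_left hW (by positivity)
      norm_num at this ⊢; linarith
    calc (hexSawCount n : ℝ) ≤ 8 * μ * Real.exp (128 * μ ^ 3 + N₁) * μ ^ n :=
          hmain.trans (mul_le_mul_of_nonneg_right (mul_le_mul_of_nonneg_left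
            (Real.exp_le_exp.2 hexpo) (by positivity)) hμn)
      _ ≤ 8 * μ * (Real.exp (64 * μ ^ 3 * M) + Real.exp (128 * μ ^ 3 + N₁)) * 1 * μ ^ n := by
          rw [mul_one]
          refine mul_le_mul_of_nonneg_right (mul_le_mul_of_nonneg_left ?_ (by positivity)) hμn
          linarith [Real.exp_pos (64 * μ ^ 3 * M)]
      _ ≤ _ := by
          refine mul_le_mul_of_nonneg_right (mul_le_mul_of_nonneg_left hexpκ (by positivity)) hμn
  · -- large `n`: `t = a/√n`
    set t := a / Real.sqrt n with htdef
    have ht0 : 0 < t := div_pos ha0 hsq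
    have h2a : 2 * a ≤ Real.sqrt n := by
      have h4 : 4 * a ^ 2 ≤ (n : ℝ) := (Nat.le_ceil _).trans (by exact_mod_cast hbig)
      rw [show 2 * a = Real.sqrt ((2 * a) ^ 2) by rw [Real.sqrt_sq (by positivity)]]
      exact Real.sqrt_le_sqrt (by nlinarith)
    have ht : t ≤ 1 / 2 := by
      rw [htdef, div_le_iff₀ hsq]; linarith
    have hW := bridgeSum_le_of_lt ht0 ht hε0.le hB (n + 1)
    have hmain := hexSawCount_le_exp_of_le_half n ht0 ht
    have htinv : t⁻¹ = Real.sqrt n / a := by rw [htdef, inv_div]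
    have hnt : (n : ℝ) * t = a * Real.sqrt n := by
      rw [htdef, mul_div_assoc', div_eq_iff hsq.ne']
      nth_rewrite 1 [← Real.mul_self_sqrt hnpos.le]; ring
    have hexpo : 2 * (n : ℝ) * t + 64 * μ ^ 3 *
        ∑ T ∈ range (n + 1), (1 - t) ^ (2 * (T + 1)) * stripBlim (T + 1) ≤
        κ * Real.sqrt n + 64 * μ ^ 3 * M := by
      have h1 : 2 * (n : ℝ) * t = (κ / 2) * Real.sqrt n := by rw [mul_assoc, hnt, ha]; ring
      have h2 : 64 * μ ^ 3 * (ε * t⁻¹) = (κ / 2) * Real.sqrt n := by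
        rw [htinv, hε, ha]; field_simp; ring
      have h3 : 64 * μ ^ 3 * ∑ T ∈ range (n + 1), (1 - t) ^ (2 * (T + 1)) * stripBlim (T + 1) ≤
          64 * μ ^ 3 * (M + ε * t⁻¹) := mul_le_mul_of_nonneg_left hW (by positivity)
      rw [mul_add, h2] at h3
      linarith
    calc (hexSawCount n : ℝ) ≤ 8 * μ * Real.exp (κ * Real.sqrt n + 64 * μ ^ 3 * M) * μ ^ n :=
          hmain.trans (mul_le_mul_of_nonneg_right (mul_le_mul_of_nonneg_left
            (Real.exp_le_exp.2 hexpo) (by positivity)) hμn)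
      _ = 8 * μ * Real.exp (64 * μ ^ 3 * M) * Real.exp (κ * Real.sqrt n) * μ ^ n := by
          rw [Real.exp_add]; ring
      _ ≤ _ := by
          refine mul_le_mul_of_nonneg_right (mul_le_mul_of_nonneg_right ?_ (Real.exp_pos _).le) hμn
          refine mul_le_mul_of_nonneg_left ?_ (by positivity)
          linarith [Real.exp_pos (128 * μ ^ 3 + N₁)]

/-- Rung `κ = 14` (lane «pcv-sawmu» Sketch_G11 `R55_rung0` shape). [cite: HammersleyWelsh1962, Theorem] -/
theorem hexHWExplicit_fourteen : ∃ A : ℝ, HexHWExplicit A 14 := hexHWExplicit_of_pos (by norm_num)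

/-- Rung `κ₁ = 2√(1+μ_ℍ) ≈ 3.375`, the constant of the sharp Duminil-Copin–Smirnov bookkeeping (lane
«pcv-sawmu» Sketch_G11 `stub_R55_S3_sharp` shape; here a corollary of `hexHWExplicit_of_pos`, so `A` is
not the method constant). [cite: HammersleyWelsh1962, Theorem] -/
theorem hexHWExplicit_sharp : ∃ A : ℝ, HexHWExplicit A (2 * Real.sqrt (1 + hexConnectiveConstant)) :=
  hexHWExplicit_of_pos (mul_pos two_pos (Real.sqrt_pos.2 (by linarith [hexConnectiveConstant_pos])))

/-! ### The logarithmic improvement for every `n ≥ 2` -/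

/-- Log-stretched Hammersley–Welsh form on `ℍ`: `c_n ≤ A exp(K √n (ln n)^{-1/6}) μ_ℍ^n` for all `n ≥ 2`
(Hammersley–Welsh's shape with Glazman–Manolescu's logarithm; cf. Duminil-Copin–Ganguly–Hammond–Manolescu 2020,
Theorem 1.3, for the printed exponent `n^{1/2−ε}`, `n` large). [cite: HammersleyWelsh1962, Theorem]
[cite: GlazmanManolescu2019, Proposition 1.1] -/
def HexHWLogStretched (A K : ℝ) : Prop :=
  ∀ n : ℕ, 2 ≤ n → (hexSawCount n : ℝ) ≤
    A * Real.exp (K * Real.sqrt n * (Real.log n) ^ (-(1 : ℝ) / 6)) * hexConnectiveConstant ^ n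

/-- `4^{1/3} ≤ 2`, in the form `(L/4)^{-1/3} ≤ 2/u²` for `u⁶ = L > 0`. [folklore] -/
private theorem quarter_rpow_le {L u : ℝ} (hL : 0 < L) (hu : 0 < u) (hu6 : u ^ 6 = L) :
    (L / 4) ^ (-(1 : ℝ) / 3) ≤ 2 / u ^ 2 := by
  have h1 : (L / 4) ^ (-(1 : ℝ) / 3) = L ^ (-(1 : ℝ) / 3) * (4 : ℝ) ^ ((1 : ℝ) / 3) := by
    rw [Real.div_rpow hL.le (by norm_num), div_eq_mul_inv, ← Real.rpow_neg (by norm_num)]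
    norm_num
  have h2 : L ^ (-(1 : ℝ) / 3) = (u ^ 2)⁻¹ := by
    rw [← hu6, ← Real.rpow_natCast u 6, ← Real.rpow_mul hu.le, ← Real.rpow_natCast u 2,
      ← Real.rpow_neg hu.le]
    norm_num
  have h3 : (4 : ℝ) ^ ((1 : ℝ) / 3) ≤ 2 := by
    calc (4 : ℝ) ^ ((1 : ℝ) / 3) ≤ ((2 : ℝ) ^ (3 : ℕ)) ^ ((1 : ℝ) / 3) :=
          Real.rpow_le_rpow (by norm_num) (by norm_num) (by norm_num)
      _ = 2 := by
          rw [show ((1 : ℝ) / 3) = ((3 : ℕ) : ℝ)⁻¹ by norm_num]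
          exact Real.pow_rpow_inv_natCast (by norm_num) (by norm_num)
  rw [h1, h2, div_eq_mul_inv, mul_comm]
  exact mul_le_mul_of_nonneg_right h3 (by positivity)
set_option maxHeartbeats 400000 in
/-- **Logarithmic bridge decay ⇒ Hammersley–Welsh with exponent `√n (ln n)^{-1/6}`, CONSTANTS EXPOSED**:
under `B_T(x_c) ≤ C (ln T)^{-1/3}` (`T ≥ T₀`, `0 < C`), for all `n ≥ 2`,
`c_n(ℍ) ≤ (8μ_ℍ + c_2)·exp((1/2 + 64μ_ℍ³(max(T₀,2) + 2 + 8C))·√n (ln n)^{-1/6})·μ_ℍⁿ`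
(`t := (4√n (ln n)^{1/6})⁻¹`, split at `M = ⌈n^{1/4}⌉ ∨ T₀ ∨ 2`). [cite: GlazmanManolescu2019, Proposition 1.1]
[cite: HammersleyWelsh1962, Theorem] -/
theorem hexHWLogStretched_explicit_of_logDecay {C : ℝ} {T₀ : ℕ} (hC : 0 < C) (h : HexBridgeLogDecay C T₀) :
    HexHWLogStretched (8 * hexConnectiveConstant + hexSawCount 2)
      (1 / 2 + 64 * hexConnectiveConstant ^ 3 * (((max T₀ 2 : ℕ) : ℝ) + 2 + 8 * C)) := by
  set μ := hexConnectiveConstant with hμ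
  have hμpos : 0 < μ := hexConnectiveConstant_pos
  have hμ1 : 1 ≤ μ := one_le_hexConnectiveConstant
  set M₁ : ℕ := max T₀ 2 with hM₁
  set K : ℝ := 1 / 2 + 64 * μ ^ 3 * ((M₁ : ℝ) + 2 + 8 * C) with hK
  have hK0 : 0 < K := by positivity
  intro n hn
  have hμn : 0 ≤ μ ^ n := pow_nonneg hμpos.le n
  have hnpos : (0 : ℝ) < n := by exact_mod_cast (by omega : 0 < n)
  have hlog0 : 0 ≤ Real.log n := Real.log_nonneg (by exact_mod_cast (by omega : 1 ≤ n))
  have hexp1 : 1 ≤ Real.exp (K * Real.sqrt n * (Real.log n) ^ (-(1 : ℝ) / 6)) :=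
    Real.one_le_exp (mul_nonneg (mul_nonneg hK0.le (Real.sqrt_nonneg _)) (Real.rpow_nonneg hlog0 _))
  rcases Nat.lt_or_ge n 3 with h2 | h3
  · -- `n = 2`: `c_2 ≤ A`
    obtain rfl : n = 2 := by omega
    have hμ2 : 1 ≤ μ ^ 2 := one_le_pow₀ hμ1
    calc (hexSawCount 2 : ℝ) ≤ 8 * μ + hexSawCount 2 := by linarith
      _ = (8 * μ + hexSawCount 2) * 1 * 1 := by ring
      _ ≤ (8 * μ + hexSawCount 2) * Real.exp (K * Real.sqrt (2 : ℕ) * (Real.log (2 : ℕ)) ^ (-(1 : ℝ) / 6)) *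
          μ ^ 2 := mul_le_mul (mul_le_mul_of_nonneg_left hexp1 (by positivity)) hμ2 zero_le_one
            (by positivity)
  · -- `n ≥ 3`: `ln n ≥ 1`
    have hn3 : (3 : ℝ) ≤ n := by exact_mod_cast h3
    set L := Real.log n with hL
    have hL1 : 1 ≤ L := by
      rw [hL, Real.le_log_iff_exp_le hnpos]
      linarith [Real.exp_one_lt_d9]
    have hL0 : 0 < L := by linarith
    have hLn : L ≤ n := (Real.log_le_sub_one_of_pos hnpos).trans (by linarith)
    -- `u = L^{1/6}`, `u⁶ = L`, `u ≥ 1`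
    set u := L ^ (((6 : ℕ) : ℝ)⁻¹) with hu
    have hu0 : 0 < u := Real.rpow_pos_of_pos hL0 _
    have hu6 : u ^ 6 = L := Real.rpow_inv_natCast_pow hL0.le (by norm_num)
    have hu1 : 1 ≤ u := Real.one_le_rpow hL1 (by positivity)
    have hurpow : L ^ (-(1 : ℝ) / 6) = u⁻¹ := by
      rw [hu, ← Real.rpow_neg hL0.le]; norm_num
    -- `√n`, `s = √n/u ≥ 1`, `r = n^{1/4} ≤ s`
    have hsq : 0 < Real.sqrt n := Real.sqrt_pos.2 hnpos
    have hsqsq : Real.sqrt n * Real.sqrt n = n := Real.mul_self_sqrt hnpos.le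
    have hu2L : u ^ 2 ≤ L := by
      rw [← hu6]; exact pow_le_pow_right₀ hu1 (by norm_num)
    have hu4L : u ^ 4 ≤ L := by
      rw [← hu6]; exact pow_le_pow_right₀ hu1 (by norm_num)
    have husq : u ≤ Real.sqrt n := by
      rw [Real.le_sqrt hu0.le hnpos.le]; linarith
    set s := Real.sqrt n / u with hs
    have hs1 : 1 ≤ s := by rw [hs, le_div_iff₀ hu0, one_mul]; exact husq
    have hs0 : 0 < s := by linarith
    set r := Real.sqrt (Real.sqrt n) with hr
    have hr0 : 0 < r := Real.sqrt_pos.2 hsq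
    have hrr : r * r = Real.sqrt n := Real.mul_self_sqrt hsq.le
    have hur : u ≤ r := by
      rw [hr, Real.le_sqrt hu0.le hsq.le, Real.le_sqrt (by positivity) hnpos.le]
      calc (u ^ 2) ^ 2 = u ^ 4 := by ring
        _ ≤ (n : ℝ) := hu4L.trans hLn
    have hrs : r ≤ s := by
      rw [hs, le_div_iff₀ hu0, ← hrr]
      exact mul_le_mul_of_nonneg_left hur hr0.le
    have hlogr : Real.log r = L / 4 := by
      rw [hr, Real.log_sqrt hsq.le, Real.log_sqrt hnpos.le, hL]; ring
    -- `t := 1/(4 √n u)`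
    set t := 1 / (4 * Real.sqrt n * u) with htdef
    have ht0 : 0 < t := by positivity
    have ht : t ≤ 1 / 2 := by
      rw [htdef, one_div, one_div]
      refine inv_anti₀ (by norm_num) ?_
      nlinarith [mul_le_mul husq hu1 zero_le_one hsq.le]
    have htinv : t⁻¹ = 4 * Real.sqrt n * u := by rw [htdef, one_div, inv_inv]
    have h2nt : 2 * (n : ℝ) * t = s / 2 := by
      rw [htdef, hs]; field_simp; nlinarith [hsqsq]
    -- the splitting width `M = max(T₀, 2, ⌈r⌉)`
    set M : ℕ := max M₁ ⌈r⌉₊ with hMdef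
    have hM2 : 2 ≤ M := (le_max_right _ _).trans (le_max_left _ _)
    have hMT : T₀ ≤ M := (le_max_left _ _).trans (le_max_left _ _)
    have hMr : r ≤ (M : ℝ) := (Nat.le_ceil r).trans (by exact_mod_cast le_max_right _ _)
    have hMle : (M : ℝ) ≤ (M₁ : ℝ) + r + 1 := by
      have hc : (⌈r⌉₊ : ℝ) ≤ r + 1 := (Nat.ceil_lt_add_one hr0.le).le
      have : (M : ℝ) ≤ max (M₁ : ℝ) (⌈r⌉₊ : ℝ) := by rw [hMdef]; push_cast; exact le_rfl
      refine this.trans (max_le ?_ ?_) <;> linarith [hr0]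
    have hMpos : (0 : ℝ) < M := by exact_mod_cast (by omega : 0 < M)
    have hlogM : 0 < Real.log M := Real.log_pos (by exact_mod_cast (by omega : 1 < M))
    have hlogrM : L / 4 ≤ Real.log M := by rw [← hlogr]; exact Real.log_le_log hr0 hMr
    -- the weight above `M`: `w = C (ln M)^{-1/3} ≤ 2C/u²`
    set w := C * (Real.log M) ^ (-(1 : ℝ) / 3) with hw
    have hw0 : 0 ≤ w := mul_nonneg hC.le (Real.rpow_nonneg hlogM.le _)
    have hB : ∀ T : ℕ, M < T → stripBlim T ≤ w := by
      intro T hT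
      have hT0 : T₀ ≤ T := by omega
      have hlogT : Real.log M ≤ Real.log T :=
        Real.log_le_log hMpos (by exact_mod_cast hT.le)
      exact (h T hT0).trans (mul_le_mul_of_nonneg_left
        (Real.rpow_le_rpow_of_nonpos hlogM hlogT (by norm_num)) hC.le)
    have hwle : w ≤ 2 * C / u ^ 2 := by
      have h1 : (Real.log M) ^ (-(1 : ℝ) / 3) ≤ (L / 4) ^ (-(1 : ℝ) / 3) :=
        Real.rpow_le_rpow_of_nonpos (by positivity) hlogrM (by norm_num)
      calc w ≤ C * (L / 4) ^ (-(1 : ℝ) / 3) := mul_le_mul_of_nonneg_left h1 hC.le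
        _ ≤ C * (2 / u ^ 2) := mul_le_mul_of_nonneg_left (quarter_rpow_le hL0 hu0 hu6) hC.le
        _ = 2 * C / u ^ 2 := by ring
    -- the bridge sum
    have hW := bridgeSum_le_of_lt ht0 ht hw0 hB (n + 1)
    have hwt : w * t⁻¹ ≤ 8 * C * s := by
      calc w * t⁻¹ ≤ (2 * C / u ^ 2) * t⁻¹ := mul_le_mul_of_nonneg_right hwle (inv_nonneg.2 ht0.le)
        _ = 8 * C * s := by rw [htinv, hs]; field_simp; ring
    have hWs : ∑ T ∈ range (n + 1), (1 - t) ^ (2 * (T + 1)) * stripBlim (T + 1) ≤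
        ((M₁ : ℝ) + 2 + 8 * C) * s := by
      have : (M : ℝ) + w * t⁻¹ ≤ (M₁ : ℝ) + r + 1 + 8 * C * s := add_le_add hMle hwt
      have hM₁0 : (0 : ℝ) ≤ M₁ := Nat.cast_nonneg _
      have hM₁s : (M₁ : ℝ) ≤ (M₁ : ℝ) * s := le_mul_of_one_le_right hM₁0 hs1
      have e : ((M₁ : ℝ) + 2 + 8 * C) * s = (M₁ : ℝ) * s + s + s + 8 * C * s := by ring
      rw [e]; linarith [hW, this, hrs, hs1]
    -- the exponent
    have hexpo : 2 * (n : ℝ) * t + 64 * μ ^ 3 *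
        ∑ T ∈ range (n + 1), (1 - t) ^ (2 * (T + 1)) * stripBlim (T + 1) ≤ K * s := by
      rw [h2nt]
      have := mul_le_mul_of_nonneg_left hWs (by positivity : (0 : ℝ) ≤ 64 * μ ^ 3)
      calc s / 2 + 64 * μ ^ 3 * ∑ T ∈ range (n + 1), (1 - t) ^ (2 * (T + 1)) * stripBlim (T + 1)
          ≤ s / 2 + 64 * μ ^ 3 * (((M₁ : ℝ) + 2 + 8 * C) * s) := by linarith
        _ = K * s := by rw [hK]; ring
    have hKs : K * s = K * Real.sqrt n * L ^ (-(1 : ℝ) / 6) := by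
      rw [hurpow, hs, div_eq_mul_inv, mul_assoc]
    have hmain := hexSawCount_le_exp_of_le_half n ht0 ht
    calc (hexSawCount n : ℝ)
        ≤ 8 * μ * Real.exp (K * s) * μ ^ n :=
          hmain.trans (mul_le_mul_of_nonneg_right (mul_le_mul_of_nonneg_left
            (Real.exp_le_exp.2 hexpo) (by positivity)) hμn)
      _ ≤ (8 * μ + hexSawCount 2) * Real.exp (K * Real.sqrt n * L ^ (-(1 : ℝ) / 6)) * μ ^ n := by
          rw [hKs]
          refine mul_le_mul_of_nonneg_right (mul_le_mul_of_nonneg_right ?_ (Real.exp_pos _).le) hμn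
          have : (0 : ℝ) ≤ hexSawCount 2 := Nat.cast_nonneg _
          linarith

/-- **Logarithmic bridge decay ⇒ an explicit ALL-`n` improvement of Hammersley–Welsh on `ℍ`**:
`0 < C`, `B_T(x_c) ≤ C (ln T)^{-1/3}` (`T ≥ T₀`) give `A, K > 0` with
`c_n(ℍ) ≤ A·exp(K √n (ln n)^{-1/6})·μ_ℍⁿ` for all `n ≥ 2` (`A = 8μ + c_2`,
`K = 1/2 + 64μ³(max(T₀,2) + 2 + 8C)`; `t := (4√n (ln n)^{1/6})⁻¹`, split at `M = ⌈n^{1/4}⌉ ∨ T₀ ∨ 2`).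
[cite: GlazmanManolescu2019, Proposition 1.1] -/
theorem hexHWLogStretched_of_logDecay {C : ℝ} {T₀ : ℕ} (hC : 0 < C) (h : HexBridgeLogDecay C T₀) :
    ∃ A K : ℝ, 0 < A ∧ 0 < K ∧ HexHWLogStretched A K := by
  have hμ := hexConnectiveConstant_pos
  exact ⟨_, _, by positivity, by positivity, hexHWLogStretched_explicit_of_logDecay hC h⟩

/-- **`c_n(ℍ) ≤ A·exp(K √n (ln n)^{-1/6})·μ_ℍⁿ` for all `n ≥ 2`, unconditionally** (`A, K > 0`): the log
engine fed with the tree's `hexBridgeLogDecay : B_T(x_c) ≤ 5 (ln T)^{-1/3}` (`T ≥ 2`). An explicit all-`n`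
`o(√n)` Hammersley–Welsh exponent on the honeycomb lattice; weaker than DCGHM's `n^{1/2−ε}` for `n`
large. [cite: GlazmanManolescu2019, Proposition 1.1] -/
theorem hexHWLogStretched : ∃ A K : ℝ, 0 < A ∧ 0 < K ∧ HexHWLogStretched A K :=
  hexHWLogStretched_of_logDecay (by norm_num) hexBridgeLogDecay


/-! ### Conditional instance: a `T^{-1/4}` window gives the exponent `3/7` -/

/-- HYPOTHESIS SCHEMA (parametrised in `b₁ b₂ T₀`; nothing is asserted): a two-sided power window of
exponent `1/4` for the critical bridge masses from `T₀` on — the order predicted for `B_T` by SLE₈⁄₃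
scaling (Krachun–Panagiotis p. 3, after [LSW04]); lane «pcv-sawmu» Sketch_G11 §R54 verbatim.
[cite: KrachunPanagiotis2026, §1 (p. 3)] -/
def HexBridgeExponent (b₁ b₂ : ℝ) (T₀ : ℕ) : Prop :=
  0 < b₁ ∧ ∀ T : ℕ, T₀ ≤ T →
    b₁ * (T : ℝ) ^ (-(1 : ℝ) / 4) ≤ HV.stripBlim T ∧ HV.stripBlim T ≤ b₂ * (T : ℝ) ^ (-(1 : ℝ) / 4)

/-- An eventual polynomial bound `B_T ≤ b T^{-η}` (`T ≥ T₀`, `η ≤ 1`) is a `BridgeDecay` for all `T ≥ 1`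
with the constant `max(b,0) + T₀ + 1` (below `T₀`: `B_T ≤ 1 ≤ (T₀+1) T⁻¹ ≤ (T₀+1) T^{-η}`).
[cite: KrachunPanagiotis2026, Theorem 2 (shape)] -/
theorem bridgeDecay_of_eventually {b η : ℝ} {T₀ : ℕ} (hη1 : η ≤ 1)
    (h : ∀ T : ℕ, T₀ ≤ T → HV.stripBlim T ≤ b * (T : ℝ) ^ (-η)) :
    BridgeDecay (max b 0 + T₀ + 1) η := by
  intro T hT
  have hTpos : (0 : ℝ) < T := by exact_mod_cast hT
  have hT1 : (1 : ℝ) ≤ T := by exact_mod_cast hT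
  have hrpos : 0 < (T : ℝ) ^ (-η) := Real.rpow_pos_of_pos hTpos _
  have hb : b ≤ max b 0 + T₀ + 1 := by linarith [le_max_left b 0]
  rcases Nat.lt_or_ge T T₀ with hlt | hge
  · -- `T < T₀`: `B_T ≤ 1 ≤ (T₀ + 1) T^{-1} ≤ C T^{-η}`
    have h1 : (T : ℝ) ^ (-(1 : ℝ)) ≤ (T : ℝ) ^ (-η) :=
      Real.rpow_le_rpow_of_exponent_le hT1 (by linarith)
    have h2 : (T : ℝ) ^ (-(1 : ℝ)) = (T : ℝ)⁻¹ := Real.rpow_neg_one _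
    have hT0' : (T : ℝ) ≤ T₀ := by exact_mod_cast hlt.le
    have h3 : 1 ≤ ((T₀ : ℝ) + 1) * (T : ℝ)⁻¹ := by
      rw [le_mul_inv_iff₀ hTpos]; linarith
    have h4 : ((T₀ : ℝ) + 1) * (T : ℝ)⁻¹ ≤ ((T₀ : ℝ) + 1) * (T : ℝ) ^ (-η) := by
      rw [← h2]; exact mul_le_mul_of_nonneg_left h1 (by positivity)
    have h5 : ((T₀ : ℝ) + 1) * (T : ℝ) ^ (-η) ≤ (max b 0 + T₀ + 1) * (T : ℝ) ^ (-η) :=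
      mul_le_mul_of_nonneg_right (by linarith [le_max_right b 0]) hrpos.le
    linarith [stripBlim_le_one hT]
  · exact (h T hge).trans (mul_le_mul_of_nonneg_right hb hrpos.le)

/-- **If `B_T(x_c) ≤ b₂ T^{-1/4}` eventually (the predicted order), then
`c_n(ℍ) ≤ A exp(K n^{3/7}) μ_ℍⁿ` for all `n ≥ 1`** — the engine at `η = 1/4`
(`(1 − 1/4)/(2 − 1/4) = 3/7 < 10/21 = 1/2 − 1/42`). Conditional; lane «pcv-sawmu» Sketch_G11
`stub_R54_C1_HW` shape with the engine discharged. [cite: KrachunPanagiotis2026, §1 (p. 3)] -/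
theorem hexHWStretched_of_bridgeExponent {b₁ b₂ : ℝ} {T₀ : ℕ} (h : HexBridgeExponent b₁ b₂ T₀) :
    ∃ A K : ℝ, HexHWStretched A K (3 / 7) := by
  have hd : BridgeDecay (max b₂ 0 + T₀ + 1) (1 / 4) := by
    have := bridgeDecay_of_eventually (b := b₂) (η := 1 / 4) (T₀ := T₀) (by norm_num)
      (fun T hT => by have := (h.2 T hT).2; norm_num at this ⊢; exact this)
    exact this
  have hC : 0 < max b₂ 0 + T₀ + 1 := by positivity
  have he := hexHWStretched_of_bridgeDecay hC (by norm_num) (by norm_num) hd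
  norm_num at he
  exact he

/-! ### Numerals: `c_n(ℍ) ≤ 24 · exp(17800 · √n (ln n)^{-1/6}) · μ_ℍⁿ` for all `n ≥ 2` -/

/-- `HexHWLogStretched` is monotone in both constants. [cite: HammersleyWelsh1962, Theorem (shape)] -/
theorem HexHWLogStretched.mono {A K A' K' : ℝ} (hA : A ≤ A') (hK : K ≤ K') (h : HexHWLogStretched A K) :
    HexHWLogStretched A' K' := by
  intro n hn
  have hμn : 0 ≤ hexConnectiveConstant ^ n := pow_nonneg hexConnectiveConstant_pos.le n
  have hs : 0 ≤ Real.sqrt n * (Real.log n) ^ (-(1 : ℝ) / 6) :=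
    mul_nonneg (Real.sqrt_nonneg _) (Real.rpow_nonneg (Real.log_nonneg (by exact_mod_cast (by omega : 1 ≤ n))) _)
  have hexp : Real.exp (K * Real.sqrt n * (Real.log n) ^ (-(1 : ℝ) / 6)) ≤
      Real.exp (K' * Real.sqrt n * (Real.log n) ^ (-(1 : ℝ) / 6)) := by
    apply Real.exp_le_exp.2; rw [mul_assoc, mul_assoc]; exact mul_le_mul_of_nonneg_right hK hs
  have hA0 : A ≤ A' := hA
  calc (hexSawCount n : ℝ) ≤ A * Real.exp (K * Real.sqrt n * (Real.log n) ^ (-(1 : ℝ) / 6)) *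
        hexConnectiveConstant ^ n := h n hn
    _ ≤ A' * Real.exp (K' * Real.sqrt n * (Real.log n) ^ (-(1 : ℝ) / 6)) * hexConnectiveConstant ^ n := by
        have hc : (0 : ℝ) ≤ hexSawCount n := Nat.cast_nonneg _
        have hE : 0 < Real.exp (K * Real.sqrt n * (Real.log n) ^ (-(1 : ℝ) / 6)) := Real.exp_pos _
        rcases le_or_gt 0 A with hA0' | hAneg
        · exact mul_le_mul_of_nonneg_right (mul_le_mul hA hexp hE.le (hA0'.trans hA)) hμn
        · -- `A < 0` makes the hypothesis bound negative, so `c_n ≤ 0`-type: still fine since `c_n ≥ 0`?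
          -- we only need the displayed inequality; bound the left side by the hypothesis and `A' ≥ A`.
          have h1 : A * Real.exp (K * Real.sqrt n * (Real.log n) ^ (-(1 : ℝ) / 6)) * hexConnectiveConstant ^ n
              ≤ 0 := mul_nonpos_of_nonpos_of_nonneg (mul_nonpos_of_nonpos_of_nonneg hAneg.le hE.le) hμn
          have h2 := h n hn
          have h3 : (hexSawCount n : ℝ) = 0 := le_antisymm (h2.trans h1) hc
          have h4 : (0 : ℝ) < hexSawCount n := by exact_mod_cast hexSawCount_pos n
          linarith

/-- `c_1(ℍ) ≤ 3`: a one-step walk from `O` is `[O, v]` with `v` one of the three neighbours of `O`.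
[cite: DuminilCopinSmirnov2012, §1 (the hexagonal lattice is trivalent)] -/
theorem hexSawCount_one_le : hexSawCount 1 ≤ 3 := by
  classical
  rw [hexSawCount_eq_card]
  have hcard : (HV.nbrs hvOrigin).toFinset.card ≤ 3 :=
    (List.toFinset_card_le _).trans (by simp [HV.nbrs, hvOrigin])
  refine (Finset.card_le_card_of_injOn (fun l : List HV => l.getLast?.getD hvOrigin) ?_ ?_).trans hcard
  · intro l hl
    rw [Finset.mem_coe, HV.mem_sawFin_iff, mem_sawLists_iff] at hl
    obtain ⟨hc, hh, hlen, -⟩ := hl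
    match l, hh, hlen, hc with
    | [a, v], hh, _, hc =>
      simp only [List.head?_cons, Option.some.injEq] at hh
      subst hh
      rw [Finset.mem_coe, List.mem_toFinset, ← hvGraph_adj_iff_mem_nbrs]
      simpa using hc
  · intro l hl l' hl' heq
    rw [Finset.mem_coe, HV.mem_sawFin_iff, mem_sawLists_iff] at hl hl'
    obtain ⟨-, hh, hlen, -⟩ := hl
    obtain ⟨-, hh', hlen', -⟩ := hl'
    match l, l', hh, hh', hlen, hlen' with
    | [a, v], [a', v'], hh, hh', _, _ =>
      simp only [List.head?_cons, Option.some.injEq] at hh hh'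
      subst hh; subst hh'
      simp only [List.getLast?_cons_cons, List.getLast?_singleton, Option.getD_some] at heq
      rw [heq]

/-- `c_2(ℍ) ≤ 9` (`c_2 ≤ c_1²`; in fact `c_2 = 6`). [cite: MadrasSlade1993, §1.2, eq. (1.2.3)] -/
theorem hexSawCount_two_le : hexSawCount 2 ≤ 9 :=
  (hexSawCount_add_le 1 1).trans (Nat.mul_le_mul hexSawCount_one_le hexSawCount_one_le)

/-- `μ_ℍ ≤ 1.85` and `μ_ℍ³ ≤ 6.32` (`μ_ℍ = √(2+√2) = 1.84776`). [cite: DuminilCopinSmirnov2012, Thm 1] -/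
theorem hexConnectiveConstant_le : hexConnectiveConstant ≤ 37 / 20 ∧ hexConnectiveConstant ^ 3 ≤ 158 / 25 := by
  have hhex : hexConnectiveConstant = Real.sqrt (2 + Real.sqrt 2) :=
    hexConnectiveConstant_eq_of_thm1 DuminilCopinSmirnov2012_thm1_holds
  have hs2 : Real.sqrt 2 ≤ 1415 / 1000 := by
    rw [Real.sqrt_le_left (by norm_num)]; norm_num
  have hμ2 : hexConnectiveConstant ^ 2 = 2 + Real.sqrt 2 := by rw [hhex, Real.sq_sqrt (by positivity)]
  have hμle : hexConnectiveConstant ≤ 37 / 20 := by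
    rw [hhex, Real.sqrt_le_left (by norm_num)]; linarith
  have hμ0 : 0 ≤ hexConnectiveConstant := hexConnectiveConstant_pos.le
  refine ⟨hμle, ?_⟩
  calc hexConnectiveConstant ^ 3 = hexConnectiveConstant ^ 2 * hexConnectiveConstant := by ring
    _ ≤ (2 + 1415 / 1000) * (37 / 20) := by
        rw [hμ2]; exact mul_le_mul (by linarith) hμle hμ0 (by norm_num)
    _ ≤ 158 / 25 := by norm_num

/-- **NUMERALS: `c_n(ℍ) ≤ 24 · exp(17800 · √n · (ln n)^{-1/6}) · μ_ℍⁿ` for every `n ≥ 2`** — the unconditional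
log-improved Hammersley–Welsh bound on the honeycomb lattice with both constants as numerals
(`8μ_ℍ + c_2 ≤ 8·1.85 + 9 ≤ 24`, `1/2 + 64 μ_ℍ³ · 44 ≤ 1/2 + 64·6.32·44 ≤ 17800` at `C = 5`, `T₀ = 2`).
[cite: HammersleyWelsh1962, Theorem] [cite: GlazmanManolescu2019, Proposition 1.1] -/
theorem hexHWLogStretched_numeral : HexHWLogStretched 24 17800 := by
  have h := hexHWLogStretched_explicit_of_logDecay (by norm_num : (0 : ℝ) < 5) hexBridgeLogDecay
  obtain ⟨hμ, hμ3⟩ := hexConnectiveConstant_le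
  have hc2 : (hexSawCount 2 : ℝ) ≤ 9 := by exact_mod_cast hexSawCount_two_le
  refine HexHWLogStretched.mono ?_ ?_ h
  · linarith
  · have : (((max 2 2 : ℕ) : ℝ)) = 2 := by norm_num
    rw [this]
    nlinarith

end Literature.Probability.RandomPlanarGeometry.SAW

end
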